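import Mathlib
import Summits.ResolutionOfSingularities.ResolutionOfSingularities.Theses.AbhyankarShadows

/-!
# Disproof of `SemivaluationShadows` — findings (cdisprove cycle 1, 2026-08-17)

Crux stmt-ResolutionOfSingularities-16757 (`AbhyankarShadows.SemivaluationShadows`, route
`AbhyankarShadows`, rank 3): for `k = k̄` of char `p`, `K/k` f.g., `O ⊆ K` a RATIONAL valuation ring
containing `k`, `R ⊆ O` f.g. and `F ⊆ R` finite, there is a SHADOW of `(R, O)` exact on `F`
(`HasShadow O R F` below = the ∃-tail verbatim).  VERDICT OF THIS CYCLE: **no kill; the crux resists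
and is very probably TRUE** (in rational rank 1 it appears to be a theorem of MacLane–Vaquié /
Kaplansky valuation theory with no resolution input).  What is PROVED here (sorry-free, `lean check`
rc 0) and LANDED under `Theorems/SemivaluationShadows/Negative/FalseWithoutRational.lean` (p151454:
(a1)+(a2)) and `…/Negative/FalseWithoutRfg.lean` (p152236: (a4)):

* (a1) `semivaluationShadows_false_without_rational` — drop "`O` rational": FALSE
  (`K = k(X)`, `O = ⊤`, `R = k`, `F = ∅`).  Mechanism: same centre + `O'` rational force the centre
  `{y ∈ R₁ : ν y < 1}` of `O` on the model `R₁` to be `φ⁻¹(𝔪_{O'})`, a closed `k`-point; for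
  `O = ⊤` it is `(0)`, so `R₁ ⊆ k`, against `Frac R₁ = k(X)`.  (So rationality of `O` is used by
  any proof exactly as "the centre on every model is a `k`-point"; a merely zero-dimensional `O`
  over a non-closed `k` would NOT do with `O'` rational kept.)
* (a2) `semivaluationShadows_false_without_fg` — drop "`K/k` finitely generated": FALSE
  (`K = k((X))`, `O = k⟦X⟧`, `R = k`, `F = ∅`; the model `R₁` f.g. with `Frac R₁ = K` makes `K`
  countable for `k = 𝔽̄₂`, but `#k((X)) ≥ 𝔠`).
* (a3) `k ⊆ O` (`hk`) is REDUNDANT: implied by `R ≤ O` (`semivaluationShadows_iff_withoutConstants`).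
  `p.Prime` / `CharP k p` are believed decoration (the statement is characteristic-free in content).
* (a4) `semivaluationShadows_false_without_Rfg` — drop "`R` finitely generated": FALSE
  (`K = k(X)`, `O = R = Oinf` the valuation ring at infinity, `F = ∅`): the sandwich `R ≤ R₁ ≤ O`
  with `R₁` f.g. is impossible because a DVR of `k(X)/k` is not a f.g. `k`-algebra (Jacobson: in
  a f.g. `k`-domain `(0) = ⋂ 𝔪`, but here every maximal ideal is `𝔪_∞ ∋ 1/X`).  `R ≤ O` is
  load-bearing in the same junk way (conclusion restates it).

## Why it resists (the provers' briefing)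

**R1. The identity / QFG locus** (prior review `IdentityShadow.lean`, seam of `Lines/birth.lean`):
`(L, φ, O', ι) = (K, incl, O, id)` is a shadow as soon as `ν(R₁ ∖ 0)` is a f.g. monoid; this covers
every `O` with value group `ℤ` (all submonoids of `ℕ` are f.g.), in particular all DISCRETE
non-Abhyankar rational valuations (transcendental formal arcs in dim ≥ 2), and Abhyankar `O` after
Knaf–Kuhlmann/Teissier Thm 6.21.  Teissier's "f.g. semigroup ⇒ Abhyankar" is for COMPLETE `R` only
(arXiv:1401.5204); the crux types primes of the f.g. model, not of `R̂`, and lets `L` be arbitrary, so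
formal primes are emulated by injective `φ` with small `O' ∩ Frac φ(R₁)` — the typing is WEAKER than
the printed conjecture (arXiv:2311.12456 p.5: `R` complete, `dim R/K_α = r`, `⋃ B_α = I`).

**R2. Rational rank 1 ⇔ arcs.**  If `rat.rk O = 1`, conjunct (5) (f.g. semigroup of `ν' ∘ φ`) forces
the group generated by that semigroup to be cyclic, so `ν' ∘ φ` is a DISCRETE rank-one semivaluation
of `R₁` with residue field `k`, i.e. (Cohen) a formal arc `α : R₁ → k⟦t⟧` centred at the centre `𝔪`
of `O`; conversely an arc gives `L = k((t))`, `O' = k⟦t⟧`, `ι(1) = γ₀`.  Hence for `rat.rk O = 1`: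
`HasShadow O R F ⇔ ∃ R₁, ∃ arc α centred at 𝔪, ∃ γ₀ ∈ Γ_{>0}` with `ν(f) = γ₀ · ord_t α(f)`
for `f ∈ F` and `γ₀ · {ord α(g) : α g ≠ 0} ⊆ ν(R₁ ∖ 0)`.  Since `ν(F)` generates a cyclic
subgroup `ℤγ_F ⊆ Γ`, the only freedom is `γ₀ = γ_F/d` with `γ_F/d ∈ Γ`.  A counterexample in rational
rank 1 would therefore be a finite `F` whose normalised value vector `(ν f/γ_F)_f` is realised by NO
arc through the centre (up to the admissible multiples `d`) — I could not produce one: on toric,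
`E₈`-type and cusp-like models monomial/unit-adjusted arcs realise every valuative vector with `d = 1`
(hand computations, all characteristics incl. 2), and in general:

**R3. A proof strategy with no resolution input (MacLane–Vaquié + Kaplansky + ACVF-QE).**
Write `K ⊇ K₀(x) ⊇` finite, `x` transcendental over `K₀` (f.g., `trdeg K₀ = trdeg K − 1`),
`ν₀ = ν|K₀`.  Since `ν|K₀(x)` is rational with `rat.rk = rat.rk ν₀`, its MacLane–Vaquié chain over
`ν₀` never terminates (a terminating chain ends residually or value transcendental), so `ν|K₀(x)` is
the stable limit of approximants `μ_β = [μ; φ_β ↦ γ_β]` (keys `φ_β ∈ O₀[x]`, `γ_β = ν(φ_β) ∈ Γ`,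
`Γ_{μ_β} ⊆ Γ`).  STABILITY LEMMA: if `μ_β(f) = ν(f)` then `φ_{β'} ∤_{μ_{β'}} f` for `β' > β`, which is
equivalent to `[μ; φ_{β'} ↦ ∞](f) = ν(f)`.  So the TRUNCATION `w = [μ; φ_{β'} ↦ ∞]` — the
semivaluation "kill the key polynomial" on `K₀[x]_{(φ_{β'})}`, residue field `K₀(θ)` (f.g.,
`trdeg − 1`), value group `Γ_μ ⊆ Γ`, rational — is EXACT on any prescribed finite subset of
`K₀(x) ∩ O` for `β' ≫ 0`; (6b) holds because `w(y) = ν(y mod φ_{β'})` and the remainder lies in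
`R₁ := R[coefficients of φ_{β'}]`; the centre clause holds once the generators `y_i − c_i` are put
into `F`.  The finite top layer `K/K₀(x)(z)` is transported by QUANTIFIER ELIMINATION for ACVF: the
sentence `∃ z, P(z) = 0 ∧ ⋀_j v(f_j(z)^{e_j}) = v(d_j)` (`e_j ν(f_j) ∈ Γ_{K₀(x)}`) is equivalent to
a quantifier-free condition on finitely many elements of `K₀(x)`, which exactness of `w` on a larger
finite set preserves; this yields a root `z'` over the residue field side and an extension `w̃` with
the right values on `F`.  Then induct on `trdeg` down to `trdeg = rat.rk` (Abhyankar; rank 1: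
discrete, identity shadow; rank ≥ 2: Knaf–Kuhlmann monomialisation + EXACT lifts `a'/b'` of the new
generators, which lie in `O` because `w(ā) = ν(a')`).  OPEN POINT of this sketch (where a
counterexample would have to live): the transported algebraic layer may acquire EXTRA RAMIFICATION
(defect traded for ramification in char `p`), giving a shadow value group `Γ' ⊄ Γ` with no ordered
embedding `ι` compatible with `F` (e.g. `Γ = ℤ[1/p]γ` and a tame index-2 jump); the freedom in `β'`,
in the root `z'` and in `R₁` should absorb it, but I have no proof.  Any counterexample must in
addition have `trdeg ≥ 4`, be non-Abhyankar and off the QFG locus (prior attack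
`CRUX-ATTACK-16757.md`: log-LU ⇒ HasShadow, so `trdeg ≤ 3` is a theorem via CP2008/09 + CJS).

**R3'. Sharper form of R3 and the residual danger zone.**  The MacLane step and the finite
top layer can be fused by MODEL COMPLETENESS of ACVF: with `K₀ ⊆ K` f.g. of `trdeg K − 1` carrying
the full rational rank, `K = K₀(x, z)` (`P(x, z) = 0`), the sentence "∃ (x, z) : P = 0 ∧
⋀_{f ∈ F⁺} v(f(x,z)^{e_f}) = v(d_f)" (`d_f ∈ K₀`, `e_f ν(f) ∈ Γ₀` — possible since `Γ/Γ₀` is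
torsion) holds in an algebraically closed valued extension of `(K, ν)`, hence in
`(K₀^alg, ν̃₀)`: there are ALGEBRAIC `θ, ζ` over `K₀` with `P(θ, ζ) = 0` and the same values on
`F⁺ ⊇ F` (plus denominators, centre and residue data).  `φ : R₁ → L := K₀(θ, ζ)` is then exact on
`F`, rational, of the right rational rank, and one inducts on `trdeg`.  EVERYTHING transfers this
way EXCEPT value-group control: `Γ_L ⊆ (1/N!)Γ₀` may exceed `Γ_ν` by a finite index (conjunct (6)
needs `Γ_L ↪ Γ_ν` compatibly with `F`, i.e. `Γ_L ⊆ Γ_ν` in rank one), and (6b).  Key polynomials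
are exactly the device that restores it in a purely transcendental layer (`Γ_{K₀(θ_β)} = Γ_μ ⊆ Γ_ν`
for `θ_β` a root of the key `φ_β`); in the algebraic layer `z/K₀(x)` ordinary augmentation steps
transport (residual polynomials are LINEAR because all residue fields are `k(ξ)` with `k = k̄`),
but a LIMIT augmentation (p-DEFECT in `K/K₀(x)` whose limit key `ψ_lim` has `deg < [K : K₀(x)]`,
so that `ψ_lim(x, z) ∈ K^×` can sit in `F`) does not transport naively.  So the only place a
counterexample to the crux can live: `trdeg ≥ 4` (prior attack), non-Abhyankar, NON-DISCRETE and
NON-`p`-DIVISIBLE value group (e.g. `Γ = ℤ[1/ℓ]γ`, `ℓ ≠ p`), and a separating transcendence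
presentation ALL of whose top layers `K/K₀(x)` carry `p`-defect seen by `F` — for every choice of
`K₀` and `x` (re-presenting `k(t, x)(x^{1/p})` as `k(t)(v)` dissolves the defect layer, as in R4's
example).  I know no such field; constructing one in Lean is far beyond a cycle (it needs a
certified transcendental Hahn series and a defect computation).

**R4. Pitfalls of the route header's Hahn-arc engine** (truncate the transfinite arc
`y_i ↦ y_i(t) ∈ k((t^ℚ))`):  (i) exponent-truncations `y^{<M}` do not respect the relations of
non-free generators — define the shadow on `k[y, z, 1/h] ⊇ R` (`y` a transcendence basis among the
generators, `z` a primitive element, ONE relation `P(y,z)=0`, `z^{(M)}` := a root of `P(y^{<M}, Z)`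
near `z` by root continuity in the algebraically closed `k((t^ℚ))`); (ii) `M > max ν(F)` is needed
for exactness (`f(y) − f(y^{<M}) ∈ t^{≥ M}` by Taylor), but `y^{<M}` is a FINITE sum only if no
support accumulates below `M`: for `K = k(t, v)`, `v = Σ_{i≥1} t^{1−2^{−i}}` (`p ≠ 2`; `Γ ⊇ ℤ[½]`,
keys `v, v²−t, (v²−t)²−4t²v, …` with values `½, 5/4, 21/8, …`) every `M > 1 = ν(t)` returns `v`
itself (identity shadow, semigroup not f.g.) and every `M ≤ 1` kills `t` — exponent truncation gives
NOTHING there, while ordinal truncations `v_n` (first `n` terms) and the MacLane key-polynomial curves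
`φ_{n} = 0` do work (`ord(v − v_n) → 1` suffices because no algebraic series can follow `v` to order
`≥ 1`, Kedlaya's criterion); (iii) `L = k((t^ℚ))` with `O' =` its valuation ring is admissible only
when `Γ` is divisible (`ι : ℚ ↪ Γ`), so in general `L := Frac(image)`, whose value group is cyclic iff
the image has `trdeg 1` over `k` (curve shadows) — transcendental images of `trdeg ≥ 2` are
non-discrete in general and violate (5).

**R5. Junk / degenerate models** (re-checked): `K = k` forces `O = ⊤` and the identity works;
`R = ⊥`, `F = ∅`: conclusion satisfiable (constant shadow into a field carrying a copy of `Γ`);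
`F ∋ 0`: harmless (`ι 0 = 0`); `F ∩ centre ≠ ∅` kills the trivial shadow `R₁ → k` only.  No
decidable/finite instance exists (∃ over `Type`-valued data) — no kit job is meaningful.

Search note: local `lit search` daemon down this session (searchd connection reset; arXiv API 0
rows); Teissier 2023 p.5 re-read from the held text (conjecture stated for COMPLETE `R`).
-/

noncomputable section

set_option linter.dupNamespace false

open Summit.ResolutionOfSingularities.ResolutionOfSingularities.Theses.AbhyankarShadows
  (SemivaluationShadows)

namespace Summit.ResolutionOfSingularities.ResolutionOfSingularities.Cruxes.SemivaluationShadows.Disproof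

/-- `HasShadow O R F`: the ∃-tail of the crux, VERBATIM (same text as `Lines/birth.lean`). -/
def HasShadow {k K : Type} [Field k] [Field K] [Algebra k K] (O : ValuationSubring K)
    (R : Subalgebra k K) (F : Finset R) : Prop :=
  ∃ (R₁ : Subalgebra k K) (hle : R ≤ R₁) (_ : R₁.toSubring ≤ O.toSubring), R₁.FG ∧
    IsFractionRing R₁ K ∧ ∃ (L : Type) (_ : Field L) (_ : Algebra k L) (φ : R₁ →ₐ[k] L)
    (O' : ValuationSubring L), Module.finrank ℤ (Additive (O'.ValueGroup)ˣ) =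
      Module.finrank ℤ (Additive (O.ValueGroup)ˣ) ∧ (∀ y : R₁, φ y ∈ O') ∧
    (∀ y : R₁, O'.valuation (φ y) < 1 ↔ O.valuation (y : K) < 1) ∧
    (∀ z : L, z ∈ O' → ∃ c : k, O'.valuation (z - algebraMap k L c) < 1) ∧
    (MonoidHom.mrange (O'.valuation.toMonoidWithZeroHom.toMonoidHom.comp
      φ.toRingHom.toMonoidHom)).FG ∧
    ∃ ι : O'.ValueGroup →*₀o O.ValueGroup, Function.Injective ι ∧
      (∀ y : R₁, φ y ≠ 0 → ∃ y' : R₁, ι (O'.valuation (φ y)) = O.valuation (y' : K)) ∧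
      ∀ x ∈ F, ι (O'.valuation (φ (Subalgebra.inclusion hle x))) = O.valuation ((x : R) : K)

/-- Sanity: the crux is `∀ data, HasShadow O R F` on the nose. -/
theorem semivaluationShadows_iff :
    SemivaluationShadows ↔
    ∀ p : ℕ, p.Prime → ∀ (k K : Type) [Field k] [CharP k p] [IsAlgClosed k] [Field K]
      [Algebra k K], (⊤ : IntermediateField k K).FG → ∀ O : ValuationSubring K,
      (∀ c : k, algebraMap k K c ∈ O) →
      (∀ x : K, x ∈ O → ∃ c : k, O.valuation (x - algebraMap k K c) < 1) →
      ∀ R : Subalgebra k K, R.FG → R.toSubring ≤ O.toSubring → ∀ F : Finset R,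
      HasShadow O R F :=
  Iff.rfl

/-! ## (a) Load-bearing hypotheses -/

/-- (a3) The hypothesis `k ⊆ O` is REDUNDANT: it follows from `R ≤ O` since `R` is a `k`-subalgebra.
So the crux is equivalent to its variant without `hk`. -/
theorem semivaluationShadows_iff_withoutConstants :
    SemivaluationShadows ↔
    ∀ p : ℕ, p.Prime → ∀ (k K : Type) [Field k] [CharP k p] [IsAlgClosed k] [Field K]
      [Algebra k K], (⊤ : IntermediateField k K).FG → ∀ O : ValuationSubring K,
      (∀ x : K, x ∈ O → ∃ c : k, O.valuation (x - algebraMap k K c) < 1) →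
      ∀ R : Subalgebra k K, R.FG → R.toSubring ≤ O.toSubring → ∀ F : Finset R,
      HasShadow O R F := by
  constructor
  · intro h p hp k K _ _ _ _ _ hfg O hrat R hR hRO F
    exact h p hp k K hfg O (fun c => hRO (R.algebraMap_mem c)) hrat R hR hRO F
  · intro h p hp k K _ _ _ _ _ hfg O _ hrat R hR hRO F
    exact h p hp k K hfg O hrat R hR hRO F


/-- The crux with the RATIONALITY hypothesis on `O`
(`∀ x ∈ O, ∃ c : k, O.valuation (x - c) < 1`) deleted; everything else verbatim. -/
def SemivaluationShadowsWithoutRational : Prop :=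
  ∀ p : ℕ, p.Prime → ∀ (k K : Type) [Field k] [CharP k p] [IsAlgClosed k] [Field K]
    [Algebra k K], (⊤ : IntermediateField k K).FG → ∀ O : ValuationSubring K,
    (∀ c : k, algebraMap k K c ∈ O) →
    ∀ R : Subalgebra k K, R.FG → R.toSubring ≤ O.toSubring → ∀ F : Finset R,
    HasShadow O R F

/-- `k(X)` is generated by `X` over `k` as a field: `⊤ = k⟮X⟯`, hence `⊤.FG`. -/
theorem intermediateField_top_fg_ratFunc (k : Type) [Field k] :
    (⊤ : IntermediateField k (RatFunc k)).FG := by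
  have htop : (⊤ : IntermediateField k (RatFunc k)) =
      IntermediateField.adjoin k {(RatFunc.X : RatFunc k)} := by
    refine le_antisymm (fun x _ => ?_) le_top
    rw [IntermediateField.mem_adjoin_simple_iff]
    exact ⟨x.num, x.denom, by
      rw [RatFunc.aeval_X_left_eq_algebraMap, RatFunc.aeval_X_left_eq_algebraMap,
        RatFunc.num_div_denom]⟩
  rw [htop]
  exact IntermediateField.fg_adjoin_of_finite (Set.finite_singleton _)

/-- The trivial valuation ring `⊤` of a field takes the value `1` on every non-zero element. -/
theorem valuation_top_eq_one {K : Type} [Field K] {z : K} (hz : z ≠ 0) :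
    (⊤ : ValuationSubring K).valuation z = 1 := by
  have hu : IsUnit (⟨z, ValuationSubring.mem_top z⟩ : (⊤ : ValuationSubring K)) :=
    isUnit_iff_exists_inv.mpr ⟨⟨z⁻¹, ValuationSubring.mem_top _⟩, Subtype.ext (mul_inv_cancel₀ hz)⟩
  exact ((⊤ : ValuationSubring K).valuation_eq_one_iff _).mp hu

/-- **`O` rational is load-bearing.** Without it the crux fails already for the TRIVIAL valuation
ring `O = ⊤` of `K = k(X)` (`k = 𝔽̄₂`, `R = k`, `F = ∅`): a shadow forces the centre
`{y ∈ R₁ : ν y < 1}` of `O` on `R₁` to be the pull-back of the maximal ideal of the RATIONAL ring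
`O'`, i.e. a `k`-point of `Spec R₁`; for `O = ⊤` the centre is `(0)`, so every `y ∈ R₁` would be a
constant, contradicting `Frac R₁ = k(X)`. (Any proof of the crux must use rationality of `O`
exactly here: the same-centre clause + rationality of `O'` say the centre of `O` on the model is a
closed `k`-point.) [folklore] -/
theorem semivaluationShadows_false_without_rational : ¬ SemivaluationShadowsWithoutRational := by
  intro h
  let k := AlgebraicClosure (ZMod 2)
  let K := RatFunc k
  obtain ⟨R₁, -, -, -, hfrac, L, _, _, φ, O', -, hφO, hcent, hrat', -⟩ :=
    h 2 Nat.prime_two k K (intermediateField_top_fg_ratFunc k) ⊤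
      (fun c => ValuationSubring.mem_top _) ⊥ Subalgebra.fg_bot
      (fun x _ => ValuationSubring.mem_top x) ∅
  -- every element of `R₁` is a constant
  have hconst : ∀ y : R₁, (y : K) ∈ Set.range (algebraMap k K) := by
    intro y
    obtain ⟨c, hc⟩ := hrat' (φ y) (hφO y)
    have h1 : φ y - algebraMap k L c = φ (y - algebraMap k R₁ c) := by
      rw [map_sub, AlgHom.commutes]
    rw [h1, hcent] at hc
    have h0 : ((y - algebraMap k R₁ c : R₁) : K) = 0 := by
      by_contra hne
      exact (lt_irrefl (1 : (⊤ : ValuationSubring K).ValueGroup))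
        ((valuation_top_eq_one hne).symm.le.trans_lt hc)
    refine ⟨c, ?_⟩
    have : ((y - algebraMap k R₁ c : R₁) : K) = (y : K) - algebraMap k K c := by
      rw [Subalgebra.coe_sub, Subalgebra.coe_algebraMap]
    rw [this, sub_eq_zero] at h0
    exact h0.symm
  -- hence `K = Frac R₁` consists of constants, which is absurd for `X`
  obtain ⟨a, b, -, hab⟩ := IsFractionRing.div_surjective (A := R₁) (RatFunc.X : K)
  obtain ⟨ca, hca⟩ := hconst a
  obtain ⟨cb, hcb⟩ := hconst b
  have hX : (RatFunc.X : K) = algebraMap k K (ca / cb) := by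
    rw [← hab, map_div₀, hca, hcb]; rfl
  have := congrArg RatFunc.num hX
  rw [RatFunc.num_X, RatFunc.algebraMap_eq_C, RatFunc.num_C] at this
  exact Polynomial.X_ne_C _ this


/-! ### `K/k` finitely generated is load-bearing (witness `K = k((X))`) -/

/-- The crux with the hypothesis `(⊤ : IntermediateField k K).FG` deleted; everything else verbatim. -/
def SemivaluationShadowsWithoutFG : Prop :=
  ∀ p : ℕ, p.Prime → ∀ (k K : Type) [Field k] [CharP k p] [IsAlgClosed k] [Field K]
    [Algebra k K], ∀ O : ValuationSubring K, (∀ c : k, algebraMap k K c ∈ O) →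
    (∀ x : K, x ∈ O → ∃ c : k, O.valuation (x - algebraMap k K c) < 1) →
    ∀ R : Subalgebra k K, R.FG → R.toSubring ≤ O.toSubring → ∀ F : Finset R,
    HasShadow O R F

open Cardinal in
/-- `𝔽̄_p` is countable. -/
theorem cardinalMk_algebraicClosure_zmod_le (p : ℕ) [Fact p.Prime] :
    #(AlgebraicClosure (ZMod p)) ≤ ℵ₀ := by
  have := Algebra.IsAlgebraic.cardinalMk_le_max (ZMod p) (AlgebraicClosure (ZMod p))
  simpa using this

open Cardinal in
/-- A finitely generated subalgebra over a countable field is countable. -/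
theorem cardinalMk_le_of_fg {k K : Type} [Field k] [Field K] [Algebra k K] (hk : #k ≤ ℵ₀)
    (R₁ : Subalgebra k K) (hfg : R₁.FG) : #R₁ ≤ ℵ₀ := by
  obtain ⟨t, ht⟩ := hfg
  have hsurj : Function.Surjective (fun q : MvPolynomial (↑(t : Set K)) k =>
      (⟨MvPolynomial.aeval Subtype.val q, by
        rw [← ht, Algebra.adjoin_eq_range]; exact ⟨q, rfl⟩⟩ : R₁)) := by
    rintro ⟨y, hy⟩
    rw [← ht, Algebra.adjoin_eq_range, AlgHom.mem_range] at hy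
    obtain ⟨q, rfl⟩ := hy
    exact ⟨q, rfl⟩
  refine (Cardinal.mk_le_of_surjective hsurj).trans (MvPolynomial.cardinalMk_le_max.trans ?_)
  exact max_le (max_le hk (Cardinal.lt_aleph0_of_finite _).le) le_rfl

open Cardinal in
/-- The fraction field of a countable ring is countable. -/
theorem cardinalMk_le_of_isFractionRing {A K : Type} [CommRing A] [Field K] [Algebra A K]
    [IsFractionRing A K] (hA : #A ≤ ℵ₀) : #K ≤ ℵ₀ := by
  have hsurj : Function.Surjective
      (fun ab : A × A => algebraMap A K ab.1 / algebraMap A K ab.2) := by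
    intro z
    obtain ⟨a, b, -, h⟩ := IsFractionRing.div_surjective (A := A) z
    exact ⟨(a, b), h⟩
  refine (Cardinal.mk_le_of_surjective hsurj).trans ?_
  rw [Cardinal.mk_prod, Cardinal.lift_id, ← Cardinal.aleph0_mul_aleph0]
  exact mul_le_mul' hA hA

open Cardinal in
/-- `k((X))` has at least continuum many elements (`0/1`-power series). -/
theorem continuum_le_cardinalMk_laurentSeries (k : Type) [Field k] : 𝔠 ≤ #(LaurentSeries k) := by
  classical
  let f : Set ℕ → LaurentSeries k := fun s =>
    HahnSeries.ofPowerSeries ℤ k (PowerSeries.mk fun n => if n ∈ s then 1 else 0)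
  have hf : Function.Injective f := by
    intro s t hst
    have h := HahnSeries.ofPowerSeries_injective hst
    ext n
    have := congrArg (PowerSeries.coeff n) h
    simp only [PowerSeries.coeff_mk] at this
    by_cases hs : n ∈ s <;> by_cases ht : n ∈ t <;> simp_all
  simpa using Cardinal.mk_le_of_injective hf

theorem algebraMap_laurentSeries_eq_C (k : Type) [Field k] (c : k) :
    algebraMap k (LaurentSeries k) c = HahnSeries.C c := by
  rw [HahnSeries.algebraMap_apply']
  simp

/-- Constants lie in the `X`-adic valuation ring of `k((X))`. -/
theorem algebraMap_mem_valuationSubring_laurentSeries (k : Type) [Field k] (c : k) :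
    algebraMap k (LaurentSeries k) c ∈ (Valued.v (R := LaurentSeries k)).valuationSubring := by
  rw [Valuation.mem_valuationSubring_iff, algebraMap_laurentSeries_eq_C]
  have h := (LaurentSeries.valuation_le_iff_coeff_lt_eq_zero k (D := 0)
    (f := HahnSeries.C c)).mpr (fun n hn => by
      rw [HahnSeries.C_apply, HahnSeries.coeff_single, if_neg hn.ne])
  simpa using h

/-- The `X`-adic valuation ring `k⟦X⟧` of `k((X))` is RATIONAL over `k`: `f ≡ f(0) (mod X)`. -/
theorem valuationSubring_laurentSeries_rational (k : Type) [Field k] (x : LaurentSeries k)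
    (hx : x ∈ (Valued.v (R := LaurentSeries k)).valuationSubring) :
    ∃ c : k, (Valued.v (R := LaurentSeries k)).valuationSubring.valuation
      (x - algebraMap k (LaurentSeries k) c) < 1 := by
  refine ⟨x.coeff 0, ?_⟩
  rw [← (Valuation.isEquiv_valuation_valuationSubring _).lt_one_iff_lt_one]
  rw [Valuation.mem_valuationSubring_iff] at hx
  have hx' : ∀ n < (0 : ℤ), x.coeff n = 0 :=
    (LaurentSeries.valuation_le_iff_coeff_lt_eq_zero k (D := 0) (f := x)).mp (by simpa using hx)
  have hle : Valued.v (x - algebraMap k (LaurentSeries k) (x.coeff 0)) ≤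
      WithZero.exp (-1 : ℤ) := by
    rw [LaurentSeries.valuation_le_iff_coeff_lt_eq_zero]
    intro n hn
    rw [HahnSeries.coeff_sub, algebraMap_laurentSeries_eq_C, HahnSeries.C_apply,
      HahnSeries.coeff_single]
    rcases lt_or_eq_of_le (Int.lt_add_one_iff.mp (by omega : n < 0 + 1)) with hn0 | hn0
    · rw [if_neg hn0.ne, hx' n hn0, sub_zero]
    · subst hn0; simp
  refine hle.trans_lt ?_
  rw [← WithZero.exp_zero, WithZero.exp_lt_exp]
  norm_num

open Cardinal in
/-- **`K/k` finitely generated is load-bearing.** Without it the crux fails for `K = k((X))`,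
`k = 𝔽̄₂`, `O = k⟦X⟧` (rational, contains `k`), `R = k`, `F = ∅`: the conclusion hands out a
finitely generated `R₁` with `Frac R₁ = K`, so `K` would be countable (`k` is), but `k((X))` has
continuum many elements. (So `hfg` is used by any proof exactly through `∃ R₁ f.g., Frac R₁ = K`;
it cannot be weakened to "`K/k` of finite transcendence degree" etc.) [folklore] -/
theorem semivaluationShadows_false_without_fg : ¬ SemivaluationShadowsWithoutFG := by
  intro h
  let k := AlgebraicClosure (ZMod 2)
  let K := LaurentSeries k
  let O : ValuationSubring K := (Valued.v (R := K)).valuationSubring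
  obtain ⟨R₁, -, -, hfg1, hfrac, -⟩ :=
    h 2 Nat.prime_two k K O (algebraMap_mem_valuationSubring_laurentSeries k)
      (valuationSubring_laurentSeries_rational k) ⊥ Subalgebra.fg_bot
      (fun x hx => by
        obtain ⟨c, rfl⟩ := Algebra.mem_bot.mp (show x ∈ (⊥ : Subalgebra k K) from hx)
        exact algebraMap_mem_valuationSubring_laurentSeries k c) ∅
  have hK : #K ≤ ℵ₀ :=
    @cardinalMk_le_of_isFractionRing R₁ K _ _ _ hfrac
      (cardinalMk_le_of_fg (cardinalMk_algebraicClosure_zmod_le 2) R₁ hfg1)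
  exact (Cardinal.aleph0_lt_continuum.trans_le
    ((continuum_le_cardinalMk_laurentSeries k).trans hK)).false

/-! ### `R` finitely generated is load-bearing (witness `O = R = Oinf ⊆ k(X)`) -/

section
open scoped Polynomial
variable (k : Type) [Field k] [DecidableEq (RatFunc k)]

/-- The valuation ring at infinity `{f : deg f ≤ 0}` of `k(X)`. -/
def Oinf : ValuationSubring (RatFunc k) := (RatFunc.inftyValuation k).valuationSubring

theorem mem_Oinf_iff (x : RatFunc k) : x ∈ Oinf k ↔ RatFunc.inftyValuation k x ≤ 1 :=
  Valuation.mem_valuationSubring_iff _ _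

theorem Oinf_lt_one_iff (x : RatFunc k) :
    (Oinf k).valuation x < 1 ↔ RatFunc.inftyValuation k x < 1 :=
  ((Valuation.isEquiv_valuation_valuationSubring _).lt_one_iff_lt_one).symm

theorem C_mem_Oinf (c : k) : algebraMap k (RatFunc k) c ∈ Oinf k := by
  rw [mem_Oinf_iff, RatFunc.algebraMap_eq_C]
  rcases eq_or_ne c 0 with rfl | hc
  · simp
  · exact (RatFunc.inftyValuation.C k hc).le

theorem inftyValuation_X_inv : RatFunc.inftyValuation k (RatFunc.X : RatFunc k)⁻¹ < 1 := by
  rw [map_inv₀, RatFunc.inftyValuation.X, ← WithZero.exp_neg, ← WithZero.exp_zero,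
    WithZero.exp_lt_exp]
  norm_num

theorem X_inv_mem_Oinf : (RatFunc.X : RatFunc k)⁻¹ ∈ Oinf k :=
  (mem_Oinf_iff k _).mpr (inftyValuation_X_inv k).le

theorem X_inv_lt_one : (Oinf k).valuation (RatFunc.X : RatFunc k)⁻¹ < 1 :=
  (Oinf_lt_one_iff k _).mpr (inftyValuation_X_inv k)

/-- `O_∞` is rational over `k`: `f ≡ (ratio of leading coefficients) mod 𝔪_∞`. -/
theorem Oinf_rational (x : RatFunc k) (hx : x ∈ Oinf k) :
    ∃ c : k, (Oinf k).valuation (x - algebraMap k (RatFunc k) c) < 1 := by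
  simp only [Oinf_lt_one_iff, RatFunc.algebraMap_eq_C]
  rw [mem_Oinf_iff] at hx
  rcases eq_or_ne x 0 with rfl | hx0
  · exact ⟨0, by simp⟩
  rw [RatFunc.inftyValuation_apply, RatFunc.inftyValuation_of_nonzero k hx0,
    ← WithZero.exp_zero, WithZero.exp_le_exp] at hx
  rcases hx.lt_or_eq with hlt | heq
  · refine ⟨0, ?_⟩
    rw [map_zero, sub_zero, RatFunc.inftyValuation_apply, RatFunc.inftyValuation_of_nonzero k hx0,
      ← WithZero.exp_zero, WithZero.exp_lt_exp]
    exact hlt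
  · -- `deg num = deg denom`: subtract the leading-coefficient constant
    have hnd : x.num.natDegree = x.denom.natDegree := by
      simp only [RatFunc.intDegree] at heq; omega
    set c : k := x.num.leadingCoeff with hc
    have hc0 : c ≠ 0 := Polynomial.leadingCoeff_ne_zero.mpr (RatFunc.num_ne_zero hx0)
    set q : k[X] := x.num - Polynomial.C c * x.denom with hq
    have hden : algebraMap k[X] (RatFunc k) x.denom ≠ 0 :=
      RatFunc.algebraMap_ne_zero (RatFunc.denom_ne_zero x)
    have hxd : x * algebraMap k[X] (RatFunc k) x.denom = algebraMap k[X] (RatFunc k) x.num :=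
      (eq_div_iff hden).mp (RatFunc.num_div_denom x).symm
    have hxq : x - RatFunc.C c =
        algebraMap k[X] (RatFunc k) q / algebraMap k[X] (RatFunc k) x.denom := by
      rw [eq_div_iff hden, sub_mul, hq, map_sub, map_mul, RatFunc.algebraMap_C, hxd]
    refine ⟨c, ?_⟩
    rw [hxq]
    rcases eq_or_ne q 0 with hq0 | hq0
    · rw [hq0, map_zero, zero_div, map_zero]; exact zero_lt_one
    have hdeg : q.natDegree < x.denom.natDegree := by
      rw [← hnd]
      refine Polynomial.natDegree_lt_natDegree hq0 ?_
      rw [hq]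
      refine Polynomial.degree_sub_lt ?_ (RatFunc.num_ne_zero hx0) ?_
      · rw [Polynomial.degree_C_mul hc0, Polynomial.degree_eq_natDegree (RatFunc.num_ne_zero hx0),
          Polynomial.degree_eq_natDegree (RatFunc.denom_ne_zero x), hnd]
      · rw [Polynomial.leadingCoeff_mul, Polynomial.leadingCoeff_C, (RatFunc.monic_denom x).leadingCoeff,
          mul_one]
    rw [map_div₀, RatFunc.inftyValuation_apply, RatFunc.inftyValuation.polynomial k hq0,
      RatFunc.inftyValuation_apply, RatFunc.inftyValuation.polynomial k (RatFunc.denom_ne_zero x),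
      ← WithZero.exp_sub, ← WithZero.exp_zero, WithZero.exp_lt_exp]
    omega

end

/-- the witness computation, over any field `k` (no `let`-bound types) -/
theorem no_shadow_for_Oinf (k : Type) [Field k] [DecidableEq (RatFunc k)]
    (h : ∀ R : Subalgebra k (RatFunc k), R.toSubring ≤ (Oinf k).toSubring → ∀ F : Finset R,
      HasShadow (Oinf k) R F) : False := by
  let RO : Subalgebra k (RatFunc k) :=
    { (Oinf k).toSubring with algebraMap_mem' := fun c => C_mem_Oinf k c }
  obtain ⟨R₁, hle, h₁O, hfg1, -, -⟩ := h RO (fun x hx => hx) ∅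
  have hmem : ∀ x : RatFunc k, x ∈ R₁ ↔ x ∈ Oinf k :=
    fun x => ⟨fun hx => h₁O hx, fun hx => hle (show x ∈ RO from hx)⟩
  haveI : Algebra.FiniteType k R₁ := (Subalgebra.fg_iff_finiteType _).mp hfg1
  haveI : IsJacobsonRing R₁ := isJacobsonRing_of_finiteType (A := k)
  -- the centre `P = {y ∈ R₁ : ν y < 1}`
  let P : Ideal R₁ :=
    { carrier := {y | (Oinf k).valuation (y : RatFunc k) < 1}
      add_mem' := fun {a b} ha hb => by
        simp only [Set.mem_setOf_eq, Subalgebra.coe_add] at ha hb ⊢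
        exact Valuation.map_add_lt _ ha hb
      zero_mem' := by simp
      smul_mem' := fun c {y} hy => by
        simp only [Set.mem_setOf_eq, smul_eq_mul, Subalgebra.coe_mul, map_mul] at hy ⊢
        calc (Oinf k).valuation (c : RatFunc k) * (Oinf k).valuation (y : RatFunc k) ≤ 1 * (Oinf k).valuation (y : RatFunc k) :=
              mul_le_mul_left ((Oinf k).valuation_le_one ⟨c, (hmem _).mp c.2⟩) _
          _ < 1 := by rw [one_mul]; exact hy }
  have hPne : P ≠ ⊤ := by
    intro hP
    have h1 : (1 : R₁) ∈ P := hP ▸ Submodule.mem_top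
    simp [P] at h1
  have hmax : ∀ M : Ideal R₁, M.IsMaximal → M = P := by
    intro M hM
    refine hM.eq_of_le hPne fun y hy => ?_
    by_contra hy1
    have hv1 : (Oinf k).valuation (y : RatFunc k) = 1 :=
      le_antisymm ((Oinf k).valuation_le_one ⟨y, (hmem _).mp y.2⟩) (not_lt.mp hy1)
    have hy0 : (y : RatFunc k) ≠ 0 := by
      intro h0; rw [h0, map_zero] at hv1; exact zero_ne_one hv1
    have hyinv : (y : RatFunc k)⁻¹ ∈ R₁ :=
      (hmem _).mpr (((Oinf k).valuation_le_one_iff _).mp (by rw [map_inv₀, hv1, inv_one]))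
    have hunit : IsUnit y :=
      isUnit_iff_exists_inv.mpr ⟨⟨(y : RatFunc k)⁻¹, hyinv⟩, Subtype.ext (mul_inv_cancel₀ hy0)⟩
    exact hM.ne_top (M.eq_top_of_isUnit_mem hy hunit)
  -- `X⁻¹` lies in every maximal ideal, hence in `jacobson ⊥ = ⊥`
  let y₀ : R₁ := ⟨(RatFunc.X : RatFunc k)⁻¹, (hmem _).mpr (X_inv_mem_Oinf k)⟩
  have hy₀P : y₀ ∈ P := X_inv_lt_one k
  have hjac : (⊥ : Ideal R₁).jacobson = ⊥ :=
    isJacobsonRing_iff_prime_eq.mp inferInstance ⊥ Ideal.isPrime_bot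
  have hy₀jac : y₀ ∈ (⊥ : Ideal R₁).jacobson := by
    rw [Ideal.jacobson, Ideal.mem_sInf]
    rintro M ⟨-, hM⟩
    rw [hmax M hM]
    exact hy₀P
  rw [hjac, Ideal.mem_bot] at hy₀jac
  exact inv_ne_zero RatFunc.X_ne_zero (congrArg Subtype.val hy₀jac)

/-- The crux with the hypothesis `R.FG` deleted; everything else verbatim. -/
def SemivaluationShadowsWithoutRFG : Prop :=
  ∀ p : ℕ, p.Prime → ∀ (k K : Type) [Field k] [CharP k p] [IsAlgClosed k] [Field K]
    [Algebra k K], (⊤ : IntermediateField k K).FG → ∀ O : ValuationSubring K,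
    (∀ c : k, algebraMap k K c ∈ O) →
    (∀ x : K, x ∈ O → ∃ c : k, O.valuation (x - algebraMap k K c) < 1) →
    ∀ R : Subalgebra k K, R.toSubring ≤ O.toSubring → ∀ F : Finset R,
    HasShadow O R F

/-- **`R` finitely generated is load-bearing** (a4): FALSE without it — witness `K = k(X)`,
`O = R = Oinf` (valuation ring at infinity), `F = ∅`: a DVR of `k(X)/k` is not a f.g. `k`-algebra
(Jacobson), yet a shadow would sandwich a f.g. `R₁` between `R` and `O`. [folklore] -/
theorem semivaluationShadows_false_without_Rfg : ¬ SemivaluationShadowsWithoutRFG := by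
  intro h
  classical
  exact no_shadow_for_Oinf (AlgebraicClosure (ZMod 2))
    (h 2 Nat.prime_two (AlgebraicClosure (ZMod 2)) (RatFunc (AlgebraicClosure (ZMod 2)))
      (intermediateField_top_fg_ratFunc _) (Oinf _) (C_mem_Oinf _) (Oinf_rational _))


/-! ### Sanity: each `Without` variant is the crux with exactly that hypothesis deleted
(so it trivially implies the crux; recorded only to pin the variants to the crux's text). -/

theorem semivaluationShadows_of_withoutRational :
    SemivaluationShadowsWithoutRational → SemivaluationShadows :=
  fun h p hp k K _ _ _ _ _ hfg O hk _ R hR hRO F => h p hp k K hfg O hk R hR hRO F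

theorem semivaluationShadows_of_withoutFG :
    SemivaluationShadowsWithoutFG → SemivaluationShadows :=
  fun h p hp k K _ _ _ _ _ _ O hk hrat R hR hRO F => h p hp k K O hk hrat R hR hRO F

theorem semivaluationShadows_of_withoutRFG :
    SemivaluationShadowsWithoutRFG → SemivaluationShadows :=
  fun h p hp k K _ _ _ _ _ hfg O hk hrat R _ hRO F => h p hp k K hfg O hk hrat R hRO F

end Summit.ResolutionOfSingularities.ResolutionOfSingularities.Cruxes.SemivaluationShadows.Disproof

end
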